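import Summits.Ventures.PercRepro.S1DisjointSumCircuitFour
import Summits.Ventures.PercRepro.RankLevelSetO

/-!
# PercRepro — THE 5-CIRCUIT-SUMMAND CONSUMER AT `(9, 4)` (p2, gen 28; SUBCLAIM-S1 §6.10 (xvii)(f))

**C-025 at `(9, 4)` holds on `M ⊕ N` whenever `M` is a finite coloop-free matroid of rank `5` and `N` is a
`5`-circuit** (rank `4`). The same consumer as `S1DisjointSumCircuitFour` one size up:
`#U(M ⊕ N; 9, 4) ≤ N_M(5, 4) + 5 · N_M(5, 3)`, `#Y(M ⊕ N; 9, 4) ≥ 31 f_M(4) + 26 f_M(5)`;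
`N_M(5, 4) ≤ f_M(5)` trivially, the cell `(5, 3)` of `M` (`SevenThree.c025_three_all`, `Φ(5, 3) = 5/4`) gives
`N_M(5, 3) ≤ (4/5) f_M(4)`, and the double count `2 f_M(4) ≤ 5 f_M(5)` closes:
`Φ(9, 4) · #U ≤ 8.4 f_M(5) + 33.6 f_M(4) ≤ 26 f_M(5) + 31 f_M(4)`. (The cell `(5, 4)` has `Φ = 0` and is not
needed.) Nothing else is claimed about any cell.

* `ySet_five_three_eq` — the `Y`-set of the cell `(5, 3)`;
* `ncard_U_disjointSum_circuit_five_le`, `ncard_Y_disjointSum_circuit_five_ge` — the two sides;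
* `consumer_arith_circuit_five`, **`c025_nine_four_disjointSum_circuit_five`** — the consumer.
Axioms: standard.
-/

open scoped Matroid

namespace PercRepro

namespace S1

open Set

variable {α : Type}

/-- The `Y`-set of the cell `(5, 3)` is the rank level `4`. -/
theorem ySet_five_three_eq (M : Matroid α) :
    {A : Set α | A ⊆ M.E ∧ ((3 : ℕ) : ℕ∞) < M.eRk A ∧ M.eRk A < ((5 : ℕ) : ℕ∞)} = rankSet M 4 := by
  ext A
  simp only [mem_setOf_eq, rankSet]
  constructor
  · rintro ⟨hAE, h1, h2⟩
    refine ⟨hAE, ?_⟩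
    obtain ⟨n, hn⟩ := ENat.ne_top_iff_exists.mp (ne_top_of_lt h2)
    rw [← hn] at h1 h2 ⊢
    have h1' : 3 < n := by exact_mod_cast h1
    have h2' : n < 5 := by exact_mod_cast h2
    have h3 : n = 4 := by omega
    rw [h3]
  · rintro ⟨hAE, hA⟩
    refine ⟨hAE, ?_⟩
    rw [hA]
    constructor
    · exact_mod_cast (show (3 : ℕ) < 4 by norm_num)
    · exact_mod_cast (show (4 : ℕ) < 5 by norm_num)

/-- **The `U`-side**: `#U(M ⊕ N; 9, 4) ≤ N_M(5, 4) + 5 · N_M(5, 3)` for `M` of rank `5` and `N` a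
`5`-circuit. -/
theorem ncard_U_disjointSum_circuit_five_le (M N : Matroid α) [M.Finite] [N.Finite] (h : Disjoint M.E N.E)
    (hM : M.eRank = 5) (hN : N.IsCircuit N.E) (hN5 : N.E.ncard = 5) :
    {A : Set α | A ⊆ (M.disjointSum N h).E ∧ (M.disjointSum N h).eRk A = ((9 : ℕ) : ℕ∞) ∧
        (M.disjointSum N h).eRk ((M.disjointSum N h).E \ A) = ((4 : ℕ) : ℕ∞)}.ncard ≤
      (profileSet M 5 4).ncard + 5 * (profileSet M 5 3).ncard := by
  have hN5' : N.E.ncard = 4 + 1 := hN5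
  have hN4 : N.eRank = ((4 : ℕ) : ℕ∞) := eRank_eq_of_isCircuit_ground hN hN5'
  have hM5 : M.eRank = ((5 : ℕ) : ℕ∞) := by exact_mod_cast hM
  rw [disjointSum_ncard_U_eq_finsum M N h 9 4, finsum_mem_coe_finset]
  rw [Finset.sum_eq_add_of_mem (5, 4) (5, 3) (by decide) (by decide) (by decide) ?_]
  · dsimp only
    rw [show (9 : ℕ) - 5 = 4 from rfl, show (4 : ℕ) - 4 = 0 from rfl, show (4 : ℕ) - 3 = 1 from rfl]
    have h0 := ncard_profileSet_top_zero_le hN hN5' (by norm_num)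
    have h1 := ncard_profileSet_top_one_le hN hN5'
    calc (profileSet M 5 4).ncard * (profileSet N 4 0).ncard +
          (profileSet M 5 3).ncard * (profileSet N 4 1).ncard
        ≤ (profileSet M 5 4).ncard * 1 + (profileSet M 5 3).ncard * (4 + 1) :=
          Nat.add_le_add (Nat.mul_le_mul_left _ h0) (Nat.mul_le_mul_left _ h1)
      _ = (profileSet M 5 4).ncard + 5 * (profileSet M 5 3).ncard := by ring
  · rintro ⟨a, b⟩ hmem ⟨hne1, hne2⟩
    rw [Finset.mem_product, Finset.mem_range, Finset.mem_range] at hmem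
    dsimp only
    rcases Nat.lt_or_ge 5 a with ha | ha
    · rw [profileSet_eq_empty_of_eRank_lt M hM5 ha b, ncard_empty, zero_mul]
    rcases Nat.lt_or_ge a 5 with ha' | ha'
    · rw [profileSet_eq_empty_of_eRank_lt N hN4 (by omega) (4 - b), ncard_empty, mul_zero]
    have ha5 : a = 5 := by omega
    subst ha5
    have hb : b ≤ 2 := by
      rcases Nat.lt_or_ge b 3 with hb | hb
      · omega
      · exfalso
        rcases Nat.lt_or_ge b 4 with hb4 | hb4
        · exact hne2 (by congr 1; omega)
        · exact hne1 (by congr 1; omega)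
    rw [show (9 : ℕ) - 5 = 4 from rfl, profileSet_top_eq_empty_of_two_le hN hN5' (by omega), ncard_empty,
      mul_zero]

/-- **The `Y`-side**: `#Y(M ⊕ N; 9, 4) ≥ 31 f_M(4) + 26 f_M(5)` for `N` a `5`-circuit — the eight slices
`(a₁, a₂)` with `a₁ ∈ {4, 5}`, with `f_N(0) ≥ 1`, `f_N(1) ≥ 5`, `f_N(2) ≥ 10`, `f_N(3) ≥ 10`, `f_N(4) ≥ 6`. -/
theorem ncard_Y_disjointSum_circuit_five_ge (M N : Matroid α) [M.Finite] [N.Finite] (h : Disjoint M.E N.E)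
    (hN : N.IsCircuit N.E) (hN5 : N.E.ncard = 5) :
    31 * (rankSet M 4).ncard + 26 * (rankSet M 5).ncard ≤
      {A : Set α | A ⊆ (M.disjointSum N h).E ∧ ((4 : ℕ) : ℕ∞) < (M.disjointSum N h).eRk A ∧
        (M.disjointSum N h).eRk A < ((9 : ℕ) : ℕ∞)}.ncard := by
  have hN5' : N.E.ncard = 4 + 1 := hN5
  rw [disjointSum_ncard_Y_eq_finsum M N h 9 4, finsum_mem_coe_finset]
  have hsub : ({(4, 1), (4, 2), (4, 3), (4, 4), (5, 0), (5, 1), (5, 2), (5, 3)} : Finset (ℕ × ℕ)) ⊆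
      (Finset.range 9 ×ˢ Finset.range 9).filter (fun x : ℕ × ℕ => 4 < x.1 + x.2 ∧ x.1 + x.2 < 9) := by
    decide
  refine le_trans ?_ (Finset.sum_le_sum_of_subset hsub)
  rw [Finset.sum_insert (by decide), Finset.sum_insert (by decide), Finset.sum_insert (by decide),
    Finset.sum_insert (by decide), Finset.sum_insert (by decide), Finset.sum_insert (by decide),
    Finset.sum_insert (by decide), Finset.sum_singleton]
  dsimp only
  have f0 : 1 ≤ (rankSet N 0).ncard := by
    have := choose_le_ncard_rankSet_of_isCircuit_ground hN hN5' (a := 0) (by norm_num)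
    rwa [Nat.choose_zero_right] at this
  have f1 : 5 ≤ (rankSet N 1).ncard := by
    have := choose_le_ncard_rankSet_of_isCircuit_ground hN hN5' (a := 1) (by norm_num)
    rwa [Nat.choose_one_right] at this
  have f2 : 10 ≤ (rankSet N 2).ncard := by
    have := choose_le_ncard_rankSet_of_isCircuit_ground hN hN5' (a := 2) (by norm_num)
    rwa [show Nat.choose (4 + 1) 2 = 10 by decide] at this
  have f3 : 10 ≤ (rankSet N 3).ncard := by
    have := choose_le_ncard_rankSet_of_isCircuit_ground hN hN5' (a := 3) (by norm_num)
    rwa [show Nat.choose (4 + 1) 3 = 10 by decide] at this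
  have f4 : 6 ≤ (rankSet N 4).ncard := ncard_rankSet_top_of_isCircuit_ground hN hN5'
  have e41 := Nat.mul_le_mul_left (rankSet M 4).ncard f1
  have e42 := Nat.mul_le_mul_left (rankSet M 4).ncard f2
  have e43 := Nat.mul_le_mul_left (rankSet M 4).ncard f3
  have e44 := Nat.mul_le_mul_left (rankSet M 4).ncard f4
  have e50 := Nat.mul_le_mul_left (rankSet M 5).ncard f0
  have e51 := Nat.mul_le_mul_left (rankSet M 5).ncard f1
  have e52 := Nat.mul_le_mul_left (rankSet M 5).ncard f2
  have e53 := Nat.mul_le_mul_left (rankSet M 5).ncard f3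
  linarith

/-- The arithmetic of the `5`-circuit consumer, abstracted: `u ≤ P₄ + 5 P₃`, `P₄ ≤ f₅`, `(5/4) P₃ ≤ f₄`,
`2 f₄ ≤ 5 f₅`, `y ≥ 31 f₄ + 26 f₅` give `(42/5) u ≤ y`. -/
theorem consumer_arith_circuit_five {u y P4 P3 f4 f5 : ℚ} (hU : u ≤ P4 + 5 * P3) (hP4 : P4 ≤ f5)
    (hY : 31 * f4 + 26 * f5 ≤ y) (h53 : 5 / 4 * P3 ≤ f4) (hdc : 2 * f4 ≤ (4 + 1) * f5) (hf4 : 0 ≤ f4) :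
    42 / 5 * u ≤ y := by
  linarith

/-- **THE 5-CIRCUIT-SUMMAND CONSUMER**: `Φ(9, 4) · #U(M ⊕ N; 9, 4) ≤ #Y(M ⊕ N; 9, 4)` for every finite
coloop-free `M` of rank `5` and every finite `N` whose ground set is a circuit of `5` elements. From the tree
cell `(5, 3)` of `M` and the double count. -/
theorem c025_nine_four_disjointSum_circuit_five (M N : Matroid α) [M.Finite] [N.Finite]
    (h : Disjoint M.E N.E) (hM : M.eRank = 5) (hcol : M.coloops = ∅) (hN : N.IsCircuit N.E)
    (hN5 : N.E.ncard = 5) :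
    phiK 9 4 * ({A : Set α | A ⊆ (M.disjointSum N h).E ∧ (M.disjointSum N h).eRk A = ((9 : ℕ) : ℕ∞) ∧
        (M.disjointSum N h).eRk ((M.disjointSum N h).E \ A) = ((4 : ℕ) : ℕ∞)}.ncard : ℚ) ≤
      ({A : Set α | A ⊆ (M.disjointSum N h).E ∧ ((4 : ℕ) : ℕ∞) < (M.disjointSum N h).eRk A ∧
        (M.disjointSum N h).eRk A < ((9 : ℕ) : ℕ∞)}.ncard : ℚ) := by
  have hU := ncard_U_disjointSum_circuit_five_le M N h hM hN hN5
  have hY := ncard_Y_disjointSum_circuit_five_ge M N h hN hN5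
  have hP4 : (profileSet M 5 4).ncard ≤ (rankSet M 5).ncard :=
    ncard_le_ncard (profileSet_subset_rankSet M 5 4) (rankSet_finite M 5)
  have h53 : (5 / 4 : ℚ) * ((profileSet M 5 3).ncard : ℚ) ≤ ((rankSet M 4).ncard : ℚ) := by
    have h0 := SevenThree.c025_three_all M 5 (by norm_num)
    unfold ThmN.RLS at h0
    rw [ThmO.phiK_five_three, ySet_five_three_eq] at h0
    exact h0
  have hM' : M.eRank = ((4 + 1 : ℕ) : ℕ∞) := by rw [hM]; norm_num
  have hdc := two_mul_ncard_rankSet_le M hM' hcol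
  rw [phiK_nine_four]
  have hU' : (({A : Set α | A ⊆ (M.disjointSum N h).E ∧ (M.disjointSum N h).eRk A = ((9 : ℕ) : ℕ∞) ∧
      (M.disjointSum N h).eRk ((M.disjointSum N h).E \ A) = ((4 : ℕ) : ℕ∞)}.ncard : ℕ) : ℚ) ≤
      ((profileSet M 5 4).ncard : ℚ) + 5 * ((profileSet M 5 3).ncard : ℚ) := by
    exact_mod_cast hU
  have hY' : 31 * ((rankSet M 4).ncard : ℚ) + 26 * ((rankSet M 5).ncard : ℚ) ≤
      (({A : Set α | A ⊆ (M.disjointSum N h).E ∧ ((4 : ℕ) : ℕ∞) < (M.disjointSum N h).eRk A ∧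
        (M.disjointSum N h).eRk A < ((9 : ℕ) : ℕ∞)}.ncard : ℕ) : ℚ) := by
    exact_mod_cast hY
  have hP4' : ((profileSet M 5 4).ncard : ℚ) ≤ ((rankSet M 5).ncard : ℚ) := by exact_mod_cast hP4
  have hdc' : 2 * ((rankSet M 4).ncard : ℚ) ≤ (4 + 1) * ((rankSet M 5).ncard : ℚ) := by
    exact_mod_cast hdc
  have hf4 : (0 : ℚ) ≤ ((rankSet M 4).ncard : ℚ) := Nat.cast_nonneg _
  exact consumer_arith_circuit_five hU' hP4' hY' h53 hdc' hf4

end S1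

end PercRepro
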